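import Summits.QuantumFields.YangMills.Theorems.BalabanLadderNTCornerPrice
import Summits.QuantumFields.YangMills.Theorems.BalabanLadderNTCeilingPriceThreePoint
import HarnessLib

/-!
# Crux `NT` (stmt-QuantumFields-19353), stub `stub_refpkgT : RefPkgT`: THE CORNER PRICE, II — the `ε`-independent floor of
# the registered clause-5 margin: `|Q3(f,g,h)| ≥ ε + 2D³‖f‖₁‖g‖₁‖h‖₁/κ¹²`, `D = 6(N − Re tr ρ(g))`

Helper file (`--supports stmt-QuantumFields-19353`) of the fleet lead prover of crux `NT` (unit `ym-spine-19353-p1`, GEN 13);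
sequel of `…NTCornerPrice` (clause 1 on the unit cube forces `C₁ ≥ D := 6(N − Re tr ρ(g))` for every `g ∈ G`; two-point
corner floor `Q2(θv,v) ≥ ε + 2D²‖v‖₁²/κ⁸`).  Hypothesis-free, general compact `G`, any `r`, any unit map `a > 0`, `a → 0`.

The registered clause-5 margin dominates its pure one-point part `2k³·S_fS_gS_h`, `k = C₁(s/κ)⁴` (GEN 12's
`CeilingPrice.tripleSum_kkk_le`), which is monotone in `C₁ ≥ D`:

* `q3_ge_cornerMargin_of_clause5_at` — at one coupling (spacing `s ≤ ℓ`), clause 1 and the registered clause-5 inequality on a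
  torus give **`ε + 2(D(s/κ)⁴)³·S_fS_gS_h ≤ |Q3_{β,L,s}(f,g,h)|`** for every `g ∈ G`;
* `q3_ge_cornerMargin_canonical` — for the registered clauses 1 and 5 (reference tori `σ+κ+1 ≤ aβ·L₀β`), for every `g` and every
  `e > 0`, eventually **`ε + 2D³‖f‖₁‖g‖₁‖h‖₁/κ¹² − e ≤ |Q3_{β,L₀β,aβ}(f,g,h)|`** (Riemann sums: GEN 12's `CeilingPrice.tendsto_envelope`).

NUMBERS (memo SIZING-19353-g13 §2): `SU(2)` fundamental `D = 24`: every instance exhibits `|Q3| ≥ 27648·‖f‖₁‖g‖₁‖h‖₁/κ¹²` on its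
reference tori; `SU(3)` fundamental `D = 27`: `39366·∏‖·‖₁/κ¹²`.

HONEST FRAMING.  Finite bookkeeping and limits over tree theorems; a necessary condition on instances of the registered stub; no
floor, not AF, not NT, not the seam, not the gap; not Clay.
-/

set_option autoImplicit false

noncomputable section

open scoped SchwartzMap
open MeasureTheory Filter Topology
open Literature.MathematicalPhysics.QuantumFieldTheory Literature.MathematicalPhysics.QuantumLattice
open Literature.Probability.LatticeModels
open Summit.QuantumFields.YangMills.Cruxes.OSLegsFromFemtoAndGap.DlrCollarTransfer

namespace Summit.QuantumFields.YangMills.Cruxes.NT.CornerPrice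

section ThreePoint

variable (G : Type) [Group G] [TopologicalSpace G] [IsTopologicalGroup G] [CompactSpace G]
  [MeasurableSpace G] [BorelSpace G] (r : LatticeRep G)

/-- **The corner floor of the clause-5 margin, one coupling.**  At coupling `β`, spacing `s ≤ ℓ`: clause 1 (constant `C₁`,
range `ℓ`) and the registered clause-5 inequality on a torus `2L+1` (`C₂, C₃ ≥ 0`) give, for EVERY `g ∈ G` with
`D := 6(N − Re tr ρ(g))`, `ε + 2(D(s/κ)⁴)³·S_fS_gS_h ≤ |Q3_{β,L,s}(f,g,h)|`. [folklore] -/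
theorem q3_ge_cornerMargin_of_clause5_at (β : ℝ) {C₁ C₂ C₃ ℓ s κ : ℝ} (hC₂ : 0 ≤ C₂) (hC₃ : 0 ≤ C₃) (hsℓ : s ≤ ℓ)
    (hE1 : ∀ (c : Fin 4 → ℤ) (b : ℕ), (b : ℝ) * s ≤ ℓ → ∀ (η η' : LGConfig 4 G) (x : Fin 4 → ℤ),
      1 ≤ depth c b x → |kerE G r β c b η (dens G r x) - kerE G r β c b η' (dens G r x)| ≤ C₁ / (depth c b x : ℝ) ^ 4)
    {f g h : 𝓢(EuclideanSpace ℝ (Fin 4), ℝ)} {ε : ℝ} {L : ℕ}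
    (hfloor : ε + ∑ x ∈ box 4 L, ∑ y ∈ box 4 L, ∑ z ∈ box 4 L,
        |f (s • siteToE x)| * |g (s • siteToE y)| * |h (s • siteToE z)| *
          (2 * ((C₁ * (s / κ) ^ 4) * (C₂ * (s / κ) ^ 4 / (1 + ‖siteToE (z - y)‖) ^ 4) +
                (C₁ * (s / κ) ^ 4) * (C₂ * (s / κ) ^ 4 / (1 + ‖siteToE (z - x)‖) ^ 4) +
                (C₁ * (s / κ) ^ 4) * (C₂ * (s / κ) ^ 4 / (1 + ‖siteToE (y - x)‖) ^ 4) +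
                (C₁ * (s / κ) ^ 4) * (C₁ * (s / κ) ^ 4) * (C₁ * (s / κ) ^ 4)) +
            C₃ * (s / κ) ^ 4 / (1 + min (min ‖siteToE (y - x)‖ ‖siteToE (z - y)‖) ‖siteToE (z - x)‖) ^ 8) ≤
      |Q3 G r β L s f g h|)
    (g₀ : G) :
    ε + 2 * (6 * ((r.N : ℝ) - (r.ρ g₀).trace.re) * (s / κ) ^ 4) ^ 3 *
        ((∑ x ∈ box 4 L, |f (s • siteToE x)|) * (∑ y ∈ box 4 L, |g (s • siteToE y)|) *
          (∑ z ∈ box 4 L, |h (s • siteToE z)|)) ≤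
      |Q3 G r β L s f g h| := by
  have hDC := six_mul_sub_trace_le_of_e1osc_at G r β hsℓ hE1 g₀
  have hD := six_mul_sub_trace_nonneg r g₀
  have hC₁ : 0 ≤ C₁ := hD.trans hDC
  have ht : 0 ≤ (s / κ) ^ 4 := by positivity
  have hlow := CeilingPrice.tripleSum_kkk_le (box 4 L) (fun x => |f (s • siteToE x)|) (fun y => |g (s • siteToE y)|)
    (fun z => |h (s • siteToE z)|) (fun _ => abs_nonneg _) (fun _ => abs_nonneg _) (fun _ => abs_nonneg _)
    hC₁ hC₂ hC₃ ht (fun x y z => (1 + ‖siteToE (z - y)‖) ^ 4) (fun x y z => (1 + ‖siteToE (z - x)‖) ^ 4)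
    (fun x y z => (1 + ‖siteToE (y - x)‖) ^ 4)
    (fun x y z => (1 + min (min ‖siteToE (y - x)‖ ‖siteToE (z - y)‖) ‖siteToE (z - x)‖) ^ 8)
    (fun _ _ _ => by positivity) (fun _ _ _ => by positivity) (fun _ _ _ => by positivity)
    (fun x y z => pow_nonneg (add_nonneg zero_le_one
      (le_min (le_min (norm_nonneg _) (norm_nonneg _)) (norm_nonneg _))) 8)
  set P := (∑ x ∈ box 4 L, |f (s • siteToE x)|) * (∑ y ∈ box 4 L, |g (s • siteToE y)|) *
    (∑ z ∈ box 4 L, |h (s • siteToE z)|) with hP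
  have hP0 : 0 ≤ P := mul_nonneg (mul_nonneg (Finset.sum_nonneg fun _ _ => abs_nonneg _)
    (Finset.sum_nonneg fun _ _ => abs_nonneg _)) (Finset.sum_nonneg fun _ _ => abs_nonneg _)
  have hpow : (6 * ((r.N : ℝ) - (r.ρ g₀).trace.re) * (s / κ) ^ 4) ^ 3 ≤ (C₁ * (s / κ) ^ 4) ^ 3 :=
    pow_le_pow_left₀ (mul_nonneg hD ht) (mul_le_mul_of_nonneg_right hDC ht) 3
  have hmono : 2 * (6 * ((r.N : ℝ) - (r.ρ g₀).trace.re) * (s / κ) ^ 4) ^ 3 * P ≤ P * (2 * (C₁ * (s / κ) ^ 4) ^ 3) := by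
    nlinarith
  linarith

/-- Algebra of the canonical variables: `2(D(a/κ)⁴)³·S_fS_gS_h = (2D³/κ¹²)·(a⁴S_f)(a⁴S_g)(a⁴S_h)`. [folklore] -/
theorem cornerMargin₃_eq_canonical (D a κ Sf Sg Sh : ℝ) :
    2 * (D * (a / κ) ^ 4) ^ 3 * (Sf * Sg * Sh) = 2 * D ^ 3 / κ ^ 12 * ((a ^ 4 * Sf) * (a ^ 4 * Sg) * (a ^ 4 * Sh)) := by
  rw [div_pow]
  ring

/-- **The corner floor of the clause-5 margin, canonical form.**  Let `a > 0`, `a → 0`; assume clause 1 of the registered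
package (range `ℓ > 0`) and its clause 5 VERBATIM for witnesses `f, g, h` supported in the ball of radius `σ` (`C₂, C₃ ≥ 0`,
`κ > 0`, reference tori `σ + κ + 1 ≤ aβ·L₀β`).  Then for every `g₀ ∈ G` and every `e > 0`, eventually in `β`,
**`ε + 2D³‖f‖₁‖g‖₁‖h‖₁/κ¹² − e ≤ |Q3_{β,L₀β,aβ}(f,g,h)|`**, `D = 6(N − Re tr ρ(g₀))`. [folklore] -/
theorem q3_ge_cornerMargin_canonical (a : ℝ → ℝ) (ha : ∀ β, 0 < a β) (ha0 : Tendsto a atTop (𝓝 0))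
    {C₁ C₂ C₃ ℓ κ σ : ℝ} (hC₂ : 0 ≤ C₂) (hC₃ : 0 ≤ C₃) (hκ : 0 < κ) (hℓ : 0 < ℓ)
    (hE1 : ∃ β₁ : ℝ, ∀ β : ℝ, β₁ ≤ β → ∀ (c : Fin 4 → ℤ) (b : ℕ), (b : ℝ) * a β ≤ ℓ →
      ∀ (η η' : LGConfig 4 G) (x : Fin 4 → ℤ), 1 ≤ depth c b x →
        |kerE G r β c b η (dens G r x) - kerE G r β c b η' (dens G r x)| ≤ C₁ / (depth c b x : ℝ) ^ 4)
    {f g h : 𝓢(EuclideanSpace ℝ (Fin 4), ℝ)}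
    (hfσ : tsupport (f : EuclideanSpace ℝ (Fin 4) → ℝ) ⊆ Metric.closedBall 0 σ)
    (hgσ : tsupport (g : EuclideanSpace ℝ (Fin 4) → ℝ) ⊆ Metric.closedBall 0 σ)
    (hhσ : tsupport (h : EuclideanSpace ℝ (Fin 4) → ℝ) ⊆ Metric.closedBall 0 σ) {ε β₅ : ℝ} {L₀ : ℝ → ℕ}
    (hfloor : ∀ β : ℝ, β₅ ≤ β → σ + κ + 1 ≤ a β * L₀ β ∧
      ε + ∑ x ∈ box 4 (L₀ β), ∑ y ∈ box 4 (L₀ β), ∑ z ∈ box 4 (L₀ β),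
          |f (a β • siteToE x)| * |g (a β • siteToE y)| * |h (a β • siteToE z)| *
            (2 * ((C₁ * (a β / κ) ^ 4) * (C₂ * (a β / κ) ^ 4 / (1 + ‖siteToE (z - y)‖) ^ 4) +
                  (C₁ * (a β / κ) ^ 4) * (C₂ * (a β / κ) ^ 4 / (1 + ‖siteToE (z - x)‖) ^ 4) +
                  (C₁ * (a β / κ) ^ 4) * (C₂ * (a β / κ) ^ 4 / (1 + ‖siteToE (y - x)‖) ^ 4) +
                  (C₁ * (a β / κ) ^ 4) * (C₁ * (a β / κ) ^ 4) * (C₁ * (a β / κ) ^ 4)) +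
              C₃ * (a β / κ) ^ 4 /
                (1 + min (min ‖siteToE (y - x)‖ ‖siteToE (z - y)‖) ‖siteToE (z - x)‖) ^ 8) ≤
        |Q3 G r β (L₀ β) (a β) f g h|)
    (g₀ : G) {e : ℝ} (he : 0 < e) :
    ∀ᶠ β in atTop, ε + 2 * (6 * ((r.N : ℝ) - (r.ρ g₀).trace.re)) ^ 3 * ((∫ y, |f y|) * (∫ y, |g y|) * (∫ y, |h y|)) /
        κ ^ 12 - e ≤ |Q3 G r β (L₀ β) (a β) f g h| := by
  obtain ⟨β₁, H1⟩ := hE1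
  set D : ℝ := 6 * ((r.N : ℝ) - (r.ρ g₀).trace.re) with hD_def
  have hL : ∀ᶠ β in atTop, σ ≤ a β * L₀ β := by
    filter_upwards [eventually_ge_atTop β₅] with β hβ5
    linarith [(hfloor β hβ5).1, hκ]
  have h1 := CeilingPrice.tendsto_envelope f hfσ a L₀ ha ha0 hL
  have h2 := CeilingPrice.tendsto_envelope g hgσ a L₀ ha ha0 hL
  have h3 := CeilingPrice.tendsto_envelope h hhσ a L₀ ha ha0 hL
  have hlim := ((h1.mul h2).mul h3).const_mul (2 * D ^ 3 / κ ^ 12)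
  have e0 : 2 * D ^ 3 / κ ^ 12 * ((∫ y, |f y|) * (∫ y, |g y|) * (∫ y, |h y|)) =
      2 * D ^ 3 * ((∫ y, |f y|) * (∫ y, |g y|) * (∫ y, |h y|)) / κ ^ 12 := by ring
  rw [e0] at hlim
  have hnear : ∀ᶠ β in atTop, 2 * D ^ 3 * ((∫ y, |f y|) * (∫ y, |g y|) * (∫ y, |h y|)) / κ ^ 12 - e <
      2 * D ^ 3 / κ ^ 12 * ((a β ^ 4 * ∑ x ∈ box 4 (L₀ β), |f (a β • siteToE x)|) *
        (a β ^ 4 * ∑ y ∈ box 4 (L₀ β), |g (a β • siteToE y)|) * (a β ^ 4 * ∑ z ∈ box 4 (L₀ β), |h (a β • siteToE z)|)) :=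
    hlim.eventually (lt_mem_nhds (by linarith))
  filter_upwards [hnear, eventually_le_of_tendsto_zero ha0 hℓ, eventually_ge_atTop β₁, eventually_ge_atTop β₅]
    with β hβn hβℓ hβ1 hβ5
  have hc := q3_ge_cornerMargin_of_clause5_at G r β hC₂ hC₃ hβℓ (H1 β hβ1) (hfloor β hβ5).2 g₀
  rw [← hD_def, cornerMargin₃_eq_canonical] at hc
  linarith

end ThreePoint

end Summit.QuantumFields.YangMills.Cruxes.NT.CornerPrice

end
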